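import Summits.CriticalPhenomena.PercolationContinuityZ3.Theorems.PercNearOneGluingNoHeavyLowerTailTwoCopyFibre

/-!
# Crux `NoHeavyLowerTail` (stmt-CriticalPhenomena-4575), certificate programme for the `|A| = 5` one-cut rung:
# evaluation kernel — mixed-radix transforms with memo arrays

The fibre coefficients of a product-form certificate are the coefficients of a product of generating
polynomials in `m` variables.  This file provides the generic machinery to compute ALL of them in
`O(m · Π ρ_i)` operations instead of `4^m`: a mixed-radix PASS (`pass`) that transforms one coordinate by a
small matrix `M k`, its iteration over the coordinates (`fwd`), and the exact specification of the result
(`rd_fwd`, `rd_fwd_full`): after all passes, entry `l` of the array is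
`Σ_q f(q) · Π_{i<m} M i (digit_i l) (digit_i q)`.  Arrays are used only as memo tables built with
`Array.ofFn` (`mkArr`) and read with a default (`rd`), so their semantics is transparent (`rd_mkArr`).
Also: mixed-radix digit arithmetic (`plc`, `dig`) and the digit Fubini / uniqueness lemmas used by the
soundness proof in `…TwoCopyEval`.  Bookkeeping only; nothing about the crux.
-/

namespace Summit.CriticalPhenomena.PercolationContinuityZ3.Theorems.TwoCopy

open Finset

/-! ## Memo arrays and small loops -/

/-- A memo table of `f` on `[0, N)`. [this work] -/
def mkArr (N : ℕ) (f : ℕ → ℤ) : Array ℤ := Array.ofFn fun i : Fin N => f i.1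

/-- Read with default `0`. [this work] -/
def rd (X : Array ℤ) (i : ℕ) : ℤ := X.getD i 0

/-- Semantics of the memo table. [this work] -/
theorem rd_mkArr (N : ℕ) (f : ℕ → ℤ) (i : ℕ) : rd (mkArr N f) i = if i < N then f i else 0 := by
  unfold rd mkArr
  rw [Array.getD_eq_getD_getElem?, Array.getElem?_ofFn]
  by_cases h : i < N <;> simp [h]

/-- `∀ i < n, g i` by tail recursion. [this work] -/
def allB (g : ℕ → Bool) : ℕ → Bool
  | 0 => true
  | n + 1 => if g n then allB g n else false

/-- Semantics of `allB`. [this work] -/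
theorem allB_iff (g : ℕ → Bool) : ∀ n, allB g n = true ↔ ∀ i < n, g i = true
  | 0 => by simp [allB]
  | n + 1 => by
    unfold allB
    by_cases h : g n = true
    · rw [if_pos h, allB_iff g n]
      refine ⟨fun H i hi => ?_, fun H i hi => H i (Nat.lt_succ_of_lt hi)⟩
      rcases Nat.lt_succ_iff_lt_or_eq.1 hi with hi | rfl
      · exact H i hi
      · exact h
    · rw [if_neg h]
      simp only [Bool.false_eq_true, false_iff, not_forall]
      exact ⟨n, Nat.lt_succ_self n, h⟩

/-! ## Mixed-radix digits -/

/-- Place value of coordinate `i` for the radix profile `r`: `Π_{i'<i} r i'`. [this work] -/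
def plc (r : ℕ → ℕ) : ℕ → ℕ
  | 0 => 1
  | i + 1 => plc r i * r i

/-- Digit `i` of `p` for the radix profile `r`. [this work] -/
def dig (r : ℕ → ℕ) (i p : ℕ) : ℕ := p / plc r i % r i

/-- Place values are positive. [this work] -/
theorem plc_pos {r : ℕ → ℕ} (hr : ∀ i, 0 < r i) : ∀ i, 0 < plc r i
  | 0 => Nat.one_pos
  | i + 1 => Nat.mul_pos (plc_pos hr i) (hr i)

/-- Place value as a product. [this work] -/
theorem plc_eq_prod (r : ℕ → ℕ) : ∀ i, plc r i = ∏ i' ∈ range i, r i'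
  | 0 => by simp [plc]
  | i + 1 => by rw [plc, plc_eq_prod r i, prod_range_succ]

/-- The constant profile `2` has place values `2^i`. [this work] -/
theorem plc_two (i : ℕ) : plc (fun _ => 2) i = 2 ^ i := by
  rw [plc_eq_prod, prod_const, card_range]

/-- Splitting off the lowest coordinate of a shifted profile. [this work] -/
theorem plc_succ_shift (s : ℕ → ℕ) : ∀ n, plc s (n + 1) = s 0 * plc (fun i => s (i + 1)) n
  | 0 => by simp [plc]
  | n + 1 => by
    rw [plc, plc_succ_shift s n, plc]
    ring

/-- Place values split additively in the index. [this work] -/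
theorem plc_add (r : ℕ → ℕ) (i : ℕ) : ∀ j, plc r (i + j) = plc r i * plc (fun x => r (i + x)) j
  | 0 => by simp [plc]
  | j + 1 => by
    rw [← Nat.add_assoc, plc, plc_add r i j, plc]
    ring

/-- Digits are below the radix. [this work] -/
theorem dig_lt {r : ℕ → ℕ} (hr : ∀ i, 0 < r i) (i p : ℕ) : dig r i p < r i := Nat.mod_lt _ (hr i)

/-- Digits below `k` ignore multiples of `plc r k`. [this work] -/
theorem dig_add_mul_plc {r : ℕ → ℕ} (hr : ∀ i, 0 < r i) {i k : ℕ} (hik : i < k) (l x : ℕ) :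
    dig r i (l + x * plc r k) = dig r i l := by
  unfold dig
  obtain ⟨j, rfl⟩ : ∃ j, k = i + 1 + j := ⟨k - (i + 1), by omega⟩
  rw [plc_add r (i + 1) j, plc]
  set c := plc (fun y => r (i + 1 + y)) j
  have e1 : l + x * (plc r i * r i * c) = l + (x * (r i * c)) * plc r i := by ring
  rw [e1, Nat.add_mul_div_right _ _ (plc_pos hr i)]
  have e2 : l / plc r i + x * (r i * c) = l / plc r i + (x * c) * r i := by ring
  rw [e2, Nat.add_mul_mod_self_right]

/-- The digit `k` of `l + x · plc r k` (`l` small) is `x mod r k`. [this work] -/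
theorem dig_add_mul_plc_self {r : ℕ → ℕ} (hr : ∀ i, 0 < r i) (k : ℕ) {l : ℕ} (hl : l < plc r k) (x : ℕ) :
    dig r k (l + x * plc r k) = x % r k := by
  unfold dig
  rw [Nat.add_mul_div_right _ _ (plc_pos hr k), Nat.div_eq_of_lt hl, zero_add]

/-- The digit `k` of `l < plc r k` vanishes. [this work] -/
theorem dig_eq_zero_of_lt {r : ℕ → ℕ} (k : ℕ) {l : ℕ} (hl : l < plc r k) : dig r k l = 0 := by
  unfold dig
  rw [Nat.div_eq_of_lt hl, Nat.zero_mod]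

/-- A number below `plc r m` is determined by its `m` digits: reconstruction. [this work] -/
theorem sum_dig_mul_plc {r : ℕ → ℕ} (hr : ∀ i, 0 < r i) : ∀ (m p : ℕ), p < plc r m →
    ∑ i ∈ range m, dig r i p * plc r i = p
  | 0, p, hp => by simp [plc] at hp; simp [hp]
  | m + 1, p, hp => by
    -- p = l + x * plc r m with l < plc r m, x < r m
    have hR := plc_pos hr m
    set l := p % plc r m
    set x := p / plc r m
    have hp' : p = l + x * plc r m := (Nat.mod_add_div' p (plc r m)).symm
    have hl : l < plc r m := Nat.mod_lt _ hR
    have hx : x < r m := by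
      rw [Nat.div_lt_iff_lt_mul hR]; rw [plc] at hp; linarith [Nat.mul_comm (plc r m) (r m)]
    rw [sum_range_succ]
    have h1 : ∑ i ∈ range m, dig r i p * plc r i = ∑ i ∈ range m, dig r i l * plc r i := by
      refine sum_congr rfl fun i hi => ?_
      rw [hp', dig_add_mul_plc hr (mem_range.1 hi)]
    rw [h1, sum_dig_mul_plc hr m l hl]
    have h2 : dig r m p = x := by
      rw [hp', dig_add_mul_plc_self hr m hl, Nat.mod_eq_of_lt hx]
    rw [h2]; exact hp'.symm

/-- Two numbers below `plc r m` with the same `m` digits are equal. [this work] -/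
theorem eq_of_dig_eq {r : ℕ → ℕ} (hr : ∀ i, 0 < r i) {m p q : ℕ} (hp : p < plc r m) (hq : q < plc r m)
    (h : ∀ i < m, dig r i p = dig r i q) : p = q := by
  rw [← sum_dig_mul_plc hr m p hp, ← sum_dig_mul_plc hr m q hq]
  exact sum_congr rfl fun i hi => by rw [h i (mem_range.1 hi)]

/-- Encoding a digit vector. [this work] -/
def enc (r : ℕ → ℕ) (m : ℕ) (v : ℕ → ℕ) : ℕ := ∑ i ∈ range m, v i * plc r i

/-- The encoding is below `plc r m`. [this work] -/
theorem enc_lt {r : ℕ → ℕ} (hr : ∀ i, 0 < r i) {v : ℕ → ℕ} : ∀ {m : ℕ}, (∀ i < m, v i < r i) → enc r m v < plc r m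
  | 0, _ => by simp [enc, plc]
  | m + 1, hv => by
    unfold enc
    rw [sum_range_succ, plc]
    have ih := enc_lt hr (m := m) fun i hi => hv i (Nat.lt_succ_of_lt hi)
    unfold enc at ih
    have hvm : v m + 1 ≤ r m := hv m (Nat.lt_succ_self m)
    calc ∑ i ∈ range m, v i * plc r i + v m * plc r m < plc r m + v m * plc r m := by linarith
      _ = (v m + 1) * plc r m := by ring
      _ ≤ r m * plc r m := Nat.mul_le_mul_right _ hvm
      _ = plc r m * r m := by ring

/-- Digits of the encoding. [this work] -/
theorem dig_enc {r : ℕ → ℕ} (hr : ∀ i, 0 < r i) {v : ℕ → ℕ} : ∀ {m : ℕ}, (∀ i < m, v i < r i) →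
    ∀ i < m, dig r i (enc r m v) = v i
  | 0, _, i, hi => absurd hi (Nat.not_lt_zero i)
  | m + 1, hv, i, hi => by
    have hv' : ∀ i < m, v i < r i := fun i hi => hv i (Nat.lt_succ_of_lt hi)
    unfold enc
    rw [sum_range_succ]
    change dig r i (enc r m v + v m * plc r m) = v i
    rcases Nat.lt_succ_iff_lt_or_eq.1 hi with hi | rfl
    · rw [dig_add_mul_plc hr hi, dig_enc hr hv' i hi]
    · rw [dig_add_mul_plc_self hr _ (enc_lt hr hv'), Nat.mod_eq_of_lt (hv _ (Nat.lt_succ_self _))]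

/-- Sums over `[0, B·R)` split along `q = l + b·R`. [this work] -/
theorem sum_range_mul_split {α : Type*} [AddCommMonoid α] (R : ℕ) (g : ℕ → α) :
    ∀ B, ∑ q ∈ range (B * R), g q = ∑ b ∈ range B, ∑ l ∈ range R, g (l + b * R)
  | 0 => by simp
  | B + 1 => by
    rw [Nat.succ_mul, sum_range_add, sum_range_mul_split R g B, sum_range_succ]
    congr 1
    exact sum_congr rfl fun l _ => by rw [Nat.add_comm]

/-- Sums over `[0, B·R)` split along `q = l + b·R`, low part outside. [this work] -/
theorem sum_range_mul_split' {α : Type*} [AddCommMonoid α] (R : ℕ) (g : ℕ → α) (B : ℕ) :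
    ∑ q ∈ range (B * R), g q = ∑ l ∈ range R, ∑ b ∈ range B, g (l + b * R) := by
  rw [sum_range_mul_split, sum_comm]

/-- **Digit Fubini**: a product of per-digit functions summed over all numbers below `plc r m` is the
product of the per-digit sums. [this work] -/
theorem sum_prod_dig {r : ℕ → ℕ} (hr : ∀ i, 0 < r i) (φ : ℕ → ℕ → ℤ) :
    ∀ m, ∑ q ∈ range (plc r m), ∏ i ∈ range m, φ i (dig r i q) = ∏ i ∈ range m, ∑ e ∈ range (r i), φ i e
  | 0 => by simp [plc]
  | m + 1 => by
    rw [plc, Nat.mul_comm (plc r m) (r m), sum_range_mul_split' (plc r m), prod_range_succ,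
      ← sum_prod_dig hr φ m, sum_mul]
    refine sum_congr rfl fun l hl => ?_
    rw [mul_sum]
    refine sum_congr rfl fun e he => ?_
    rw [prod_range_succ, dig_add_mul_plc_self hr m (mem_range.1 hl), Nat.mod_eq_of_lt (mem_range.1 he)]
    congr 1
    exact prod_congr rfl fun i hi => by rw [dig_add_mul_plc hr (mem_range.1 hi)]

/-- **Digit indicator**: summing an indicator of a prescribed digit vector picks out its encoding. [this work] -/
theorem sum_ite_dig_eq {α : Type*} [AddCommMonoid α] {r : ℕ → ℕ} (hr : ∀ i, 0 < r i) {m : ℕ} {v : ℕ → ℕ}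
    (hv : ∀ i < m, v i < r i) (g : ℕ → α) :
    ∑ p ∈ range (plc r m), (if ∀ i < m, dig r i p = v i then g p else 0) = g (enc r m v) := by
  rw [← sum_filter]
  have hfl : (range (plc r m)).filter (fun p => ∀ i < m, dig r i p = v i) = {enc r m v} := by
    ext p
    simp only [mem_filter, mem_range, mem_singleton]
    constructor
    · rintro ⟨hp, hd⟩
      exact eq_of_dig_eq hr hp (enc_lt hr hv) fun i hi => by rw [hd i hi, dig_enc hr hv i hi]
    · rintro rfl
      exact ⟨enc_lt hr hv, dig_enc hr hv⟩
  rw [hfl, sum_singleton]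

/-! ## The transform -/

/-- The unrolled inner sum `Σ_{b < rin} M k e b · X[base + b·R]` (`rin ≤ 4`; no closure is allocated). [this work] -/
def term4 (M : ℕ → ℕ → ℕ → ℤ) (k e rin : ℕ) (X : Array ℤ) (base R : ℕ) : ℤ :=
  (if 0 < rin then M k e 0 * rd X base else 0) + (if 1 < rin then M k e 1 * rd X (base + R) else 0) +
    (if 2 < rin then M k e 2 * rd X (base + 2 * R) else 0) + (if 3 < rin then M k e 3 * rd X (base + 3 * R) else 0)

/-- `term4` is the `Finset.range` sum. [this work] -/
theorem term4_eq (M : ℕ → ℕ → ℕ → ℤ) (k e : ℕ) {rin : ℕ} (h4 : rin ≤ 4) (X : Array ℤ) (base R : ℕ) :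
    term4 M k e rin X base R = ∑ b ∈ range rin, M k e b * rd X (base + b * R) := by
  interval_cases rin <;> simp [term4, sum_range_succ, two_mul, add_assoc]

/-- One pass on coordinate `k`: the coordinate is converted from input radix `rin k` to output radix
`rout k` through the matrix `M k`; coordinates `< k` are already in output radices (low part, place
values `plc rout`), coordinates `> k` still in input radices (high part, `Nh` values). [this work] -/
def pass (rin rout : ℕ → ℕ) (M : ℕ → ℕ → ℕ → ℤ) (k Nh : ℕ) (X : Array ℤ) : Array ℤ :=
  let R := plc rout k
  let ro := rout k
  let ri := rin k
  mkArr (Nh * ro * R) fun p => term4 M k (p / R % ro) ri X (p / R / ro * ri * R + p % R) R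

/-- The first `k` passes (coordinates `0, …, k−1`) of an `m`-coordinate transform. [this work] -/
def fwd (rin rout : ℕ → ℕ) (M : ℕ → ℕ → ℕ → ℤ) (m : ℕ) : ℕ → Array ℤ → Array ℤ
  | 0, X => X
  | k + 1, X => pass rin rout M k (plc (fun i => rin (k + 1 + i)) (m - (k + 1))) (fwd rin rout M m k X)

/-- Semantics of one pass at a decomposed index. [this work] -/
theorem rd_pass (rin rout : ℕ → ℕ) (M : ℕ → ℕ → ℕ → ℤ) (k Nh : ℕ) (X : Array ℤ) (h4 : rin k ≤ 4)
    (hR : 0 < plc rout k) (hρ : 0 < rout k) {h e l : ℕ} (hh : h < Nh) (he : e < rout k) (hl : l < plc rout k) :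
    rd (pass rin rout M k Nh X) (l + (e + h * rout k) * plc rout k) =
      ∑ b ∈ range (rin k), M k e b * rd X (l + (b + h * rin k) * plc rout k) := by
  unfold pass
  simp only []
  rw [rd_mkArr]
  have hidx : l + (e + h * rout k) * plc rout k < Nh * rout k * plc rout k := by
    have h1 : e + h * rout k < Nh * rout k :=
      calc e + h * rout k < rout k + h * rout k := by omega
        _ = (h + 1) * rout k := by ring
        _ ≤ Nh * rout k := Nat.mul_le_mul_right _ hh
    calc l + (e + h * rout k) * plc rout k < plc rout k + (e + h * rout k) * plc rout k := by omega
      _ = (e + h * rout k + 1) * plc rout k := by ring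
      _ ≤ (Nh * rout k) * plc rout k := Nat.mul_le_mul_right _ h1
  rw [if_pos hidx]
  have h1 : (l + (e + h * rout k) * plc rout k) % plc rout k = l := by
    rw [Nat.add_mul_mod_self_right, Nat.mod_eq_of_lt hl]
  have h2 : (l + (e + h * rout k) * plc rout k) / plc rout k = e + h * rout k := by
    rw [Nat.add_mul_div_right _ _ hR, Nat.div_eq_of_lt hl, zero_add]
  have h3 : (e + h * rout k) % rout k = e := by rw [Nat.add_mul_mod_self_right, Nat.mod_eq_of_lt he]
  have h4' : (e + h * rout k) / rout k = h := by rw [Nat.add_mul_div_right _ _ hρ, Nat.div_eq_of_lt he, zero_add]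
  simp only [h1, h2, h3, h4']
  rw [term4_eq _ _ _ h4]
  refine sum_congr rfl fun b _ => ?_
  rw [show h * rin k * plc rout k + l + b * plc rout k = l + (b + h * rin k) * plc rout k by ring]

/-- **Semantics of the transform after `k` passes**: at the index with high part `h` (remaining input
coordinates) and low part `l` (transformed coordinates),
`fwd … k X₀ [l + h·plc rout k] = Σ_{q < plc rin k} f(q + h·plc rin k) · Π_{i<k} M i (dig rout i l) (dig rin i q)`.
[this work] -/
theorem rd_fwd (rin rout : ℕ → ℕ) (M : ℕ → ℕ → ℕ → ℤ) (hrin : ∀ i, 0 < rin i) (hrin4 : ∀ i, rin i ≤ 4)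
    (hrout : ∀ i, 0 < rout i) (m : ℕ) (f : ℕ → ℤ) : ∀ k, k ≤ m → ∀ h, h < plc (fun i => rin (k + i)) (m - k) → ∀ l, l < plc rout k →
    rd (fwd rin rout M m k (mkArr (plc rin m) f)) (l + h * plc rout k) =
      ∑ q ∈ range (plc rin k), f (q + h * plc rin k) * ∏ i ∈ range k, M i (dig rout i l) (dig rin i q)
  | 0, _, h, hh, l, hl => by
    simp only [plc, Nat.lt_one_iff] at hl
    subst hl
    simp only [fwd, plc, range_one, sum_singleton, prod_range_zero, mul_one, zero_add]
    rw [rd_mkArr]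
    have hh' : h < plc rin m := by simpa using hh
    rw [if_pos hh']
  | k + 1, hk, h, hh, l', hl' => by
    have hR := plc_pos hrout k
    have hρ := hrout k
    -- decompose l' = l + e * plc rout k
    set l := l' % plc rout k with hl_def
    set e := l' / plc rout k with he_def
    have hl : l < plc rout k := Nat.mod_lt _ hR
    have he : e < rout k := by
      rw [he_def, Nat.div_lt_iff_lt_mul hR]
      rw [plc] at hl'; linarith [Nat.mul_comm (plc rout k) (rout k)]
    have hl'eq : l' = l + e * plc rout k := (Nat.mod_add_div' l' (plc rout k)).symm
    have hidx : l' + h * plc rout (k + 1) = l + (e + h * rout k) * plc rout k := by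
      rw [hl'eq, plc]; ring
    rw [hidx, fwd, rd_pass rin rout M k _ _ (hrin4 k) hR hρ hh he hl]
    -- the inductive hypothesis at level k, high part b + h * rin k
    have hNh : ∀ b < rin k, b + h * rin k < plc (fun i => rin (k + i)) (m - k) := by
      intro b hb
      obtain ⟨n, hn⟩ : ∃ n, m - k = n + 1 := ⟨m - (k + 1), by omega⟩
      rw [hn, plc_succ_shift]
      have hh' : h < plc (fun i => rin (k + 1 + i)) n := by
        have : m - (k + 1) = n := by omega
        rw [this] at hh
        simpa [Nat.add_assoc, Nat.add_comm, Nat.add_left_comm] using hh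
      simp only [Nat.add_zero]
      have e3 : (fun i => rin (k + (i + 1))) = (fun i => rin (k + 1 + i)) := by
        funext i; rw [Nat.add_assoc, Nat.add_comm 1 i]
      rw [e3]
      calc b + h * rin k < rin k + h * rin k := by omega
        _ = (h + 1) * rin k := by ring
        _ ≤ plc (fun i => rin (k + 1 + i)) n * rin k := Nat.mul_le_mul_right _ hh'
        _ = rin k * plc (fun i => rin (k + 1 + i)) n := by ring
    have IH : ∀ b ∈ range (rin k), M k e b * rd (fwd rin rout M m k (mkArr (plc rin m) f)) (l + (b + h * rin k) * plc rout k) =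
        M k e b * ∑ q ∈ range (plc rin k), f (q + (b + h * rin k) * plc rin k) * ∏ i ∈ range k, M i (dig rout i l) (dig rin i q) := by
      intro b hb
      rw [rd_fwd rin rout M hrin hrin4 hrout m f k (Nat.le_of_succ_le hk) _ (hNh b (mem_range.1 hb)) l hl]
    rw [sum_congr rfl IH]
    -- reorganise the right-hand side along q' = q + b * plc rin k
    rw [plc, Nat.mul_comm (plc rin k) (rin k), sum_range_mul_split (plc rin k)]
    refine sum_congr rfl fun b hb => ?_
    rw [mul_sum]
    refine sum_congr rfl fun q hq => ?_
    have hq' := mem_range.1 hq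
    have hb' := mem_range.1 hb
    rw [prod_range_succ]
    -- digits of the combined indices
    have d1 : dig rout k l' = e := by rw [hl'eq, dig_add_mul_plc_self hrout k hl, Nat.mod_eq_of_lt he]
    have d2 : ∀ i ∈ range k, M i (dig rout i l') (dig rin i (q + b * plc rin k)) = M i (dig rout i l) (dig rin i q) := by
      intro i hi
      rw [hl'eq, dig_add_mul_plc hrout (mem_range.1 hi), dig_add_mul_plc hrin (mem_range.1 hi)]
    have d3 : dig rin k (q + b * plc rin k) = b := by rw [dig_add_mul_plc_self hrin k hq', Nat.mod_eq_of_lt hb']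
    rw [prod_congr rfl d2, d1, d3]
    have e4 : q + (b + h * rin k) * plc rin k = q + b * plc rin k + h * (rin k * plc rin k) := by ring
    rw [e4]; ring

/-- **Semantics of the full transform** (`k = m`, no high part). [this work] -/
theorem rd_fwd_full (rin rout : ℕ → ℕ) (M : ℕ → ℕ → ℕ → ℤ) (hrin : ∀ i, 0 < rin i) (hrin4 : ∀ i, rin i ≤ 4)
    (hrout : ∀ i, 0 < rout i) (m : ℕ) (f : ℕ → ℤ) {l : ℕ} (hl : l < plc rout m) :
    rd (fwd rin rout M m m (mkArr (plc rin m) f)) l =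
      ∑ q ∈ range (plc rin m), f q * ∏ i ∈ range m, M i (dig rout i l) (dig rin i q) := by
  have h := rd_fwd rin rout M hrin hrin4 hrout m f m le_rfl 0 (by simp [plc]) l hl
  simp only [zero_mul, add_zero] at h
  exact h

end Summit.CriticalPhenomena.PercolationContinuityZ3.Theorems.TwoCopy
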